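import Literature.Analysis.Calculus.QuadraticSolutionMapDeriv
import Literature.Analysis.ODE.SingularGronwall
import Literature.Analysis.UnboundedOperators.SemilinearMildFlowOperators
import Literature.Analysis.UnboundedOperators.WeaklySingularDuhamel
import HarnessLib

/-!
# Lipschitz stability of bounded mild solutions of an abstract semilinear parabolic equation

Analysis/UnboundedOperators support file (everything proved; no definitions, no named facts).  Let `E` be
a real normed space, `T(t)` (`t ≥ 0`) contractions, `K(t)` (`t > 0`) bounded operators, strongly
continuous on `(0, ∞)` with `‖K(t)‖ ≤ C t^{−α}` (`C ≥ 0`, `α < 1`), `N` a bounded bilinear map and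
`f ∈ E`.  Two continuous curves `u`, `v` solving the mild equation

  `y(t) = T(t) y₀ + ∫₀ᵗ T(t − s) f ds − ∫₀ᵗ K(t − s) N(y(s), y(s)) ds`

on `[0, L']` from `x`, `x'` and bounded there by `R` satisfy

  `‖u(t) − v(t)‖ ≤ Lip ‖x − x'‖`  on `[0, L']`,

with ONE constant `Lip = Lip(α, C, ‖N‖ R, L) ≥ 1` for all horizons `L' ≤ L`
(`exists_forall_norm_sub_le_of_mild`).  This is D. Henry, *Geometric Theory of Semilinear Parabolic
Equations*, LNM 840 (1981), Thm. 3.4.1 (Lipschitz continuous dependence on the initial value; also the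
uniqueness part of Thm. 3.3.3 when `x = x'`): the difference `d = ‖u − v‖` obeys
`d(t) ≤ ‖x − x'‖ + 2 C ‖N‖ R ∫₀ᵗ (t − s)^{−α} d(s) ds` (`N(u,u) − N(v,v) = N(u, u − v) + N(u − v, v)`),
and Henry's singular Grönwall inequality (Lemma 7.1.1, here the tree's
`Literature.Analysis.ODE.singular_gronwall_uniform`) bounds `d ≤ Lip ‖x − x'‖`.  It is the stability
estimate behind the continuation of mild solutions in a tube around a reference trajectory and the
continuity of the solution map into `C([0, L]; E)`.

## References

* D. Henry, *Geometric Theory of Semilinear Parabolic Equations*, LNM 840, Springer (1981), Thm. 3.3.3,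
  Thm. 3.4.1, Lemma 7.1.1. [Henry1981]
* A. Pazy, *Semigroups of Linear Operators and Applications to Partial Differential Equations*, Springer
  (1983), §6.3, Thm. 6.3.1 (Lipschitz dependence, (3.11)). [Pazy1983]
-/

open Set Filter MeasureTheory intervalIntegral
open _root_.Topology

namespace Literature.Analysis.UnboundedOperators

variable {E : Type*} [NormedAddCommGroup E] [NormedSpace ℝ E]

/-- **Lipschitz stability of bounded mild solutions, uniformly in the horizon** (Henry 1981,
Thm. 3.4.1; Pazy 1983, Thm. 6.3.1).  Let `T(t)` be contractions (`t ≥ 0`), `K(t)` bounded operators,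
strongly continuous on `(0, ∞)`, with `‖K(t)‖ ≤ C t^{−α}` (`C ≥ 0`, `α < 1`), `N` bounded bilinear,
`f ∈ E`, and `R`, `L` reals.  There is `Lip ≥ 1` such that for every `L' ≤ L` and all continuous
`u, v : ℝ → E` with `u(t) = T(t) x + ∫₀ᵗ T(t − s) f ds − ∫₀ᵗ K(t − s) N(u(s), u(s)) ds` and
`v(t) = T(t) x' + ∫₀ᵗ T(t − s) f ds − ∫₀ᵗ K(t − s) N(v(s), v(s)) ds` for `t ∈ [0, L']`, and
`‖u(t)‖, ‖v(t)‖ ≤ R` on `[0, L']`, one has `‖u(t) − v(t)‖ ≤ Lip ‖x − x'‖` for all `t ∈ [0, L']`.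
[cite: Henry1981, Thm 3.4.1] -/
theorem exists_forall_norm_sub_le_of_mild (T K : ℝ → E →L[ℝ] E) (hTnorm : ∀ t, 0 ≤ t → ‖T t‖ ≤ 1)
    {α C : ℝ} (hα : α < 1) (hC : 0 ≤ C) (hK : ∀ t, 0 < t → ‖K t‖ ≤ C * t ^ (-α))
    (hKc : ∀ y : E, ContinuousOn (fun t : ℝ => K t y) (Ioi 0)) (N : E →L[ℝ] E →L[ℝ] E) (f : E)
    (R L : ℝ) :
    ∃ Lip : ℝ, 1 ≤ Lip ∧ ∀ L' ≤ L, ∀ (u v : ℝ → E) (x x' : E), Continuous u → Continuous v →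
      (∀ t ∈ Icc 0 L', u t = T t x + (∫ s in (0 : ℝ)..t, T (t - s) f) -
        ∫ s in (0 : ℝ)..t, K (t - s) (N (u s) (u s))) →
      (∀ t ∈ Icc 0 L', v t = T t x' + (∫ s in (0 : ℝ)..t, T (t - s) f) -
        ∫ s in (0 : ℝ)..t, K (t - s) (N (v s) (v s))) →
      (∀ t ∈ Icc 0 L', ‖u t‖ ≤ R) → (∀ t ∈ Icc 0 L', ‖v t‖ ≤ R) →
      ∀ t ∈ Icc 0 L', ‖u t - v t‖ ≤ Lip * ‖x - x'‖ := by
  obtain ⟨Cg, hCg1, hCg⟩ :=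
    Literature.Analysis.ODE.singular_gronwall_uniform hα (C * (‖N‖ * (R + R))) L
  refine ⟨Cg, hCg1, fun L' hL' u v x x' hu hv hU hV huR hvR t ht => ?_⟩
  set d : ℝ → ℝ := fun s => ‖u s - v s‖ with hd
  have hdc : Continuous d := (hu.sub hv).norm
  refine hCg L' hL' ‖x - x'‖ d hdc.continuousOn (fun s _ => norm_nonneg _) (fun s hs => ?_) t ht
  -- the integral inequality for `d` at `s ∈ [0, L']`
  have hgu : Continuous fun r => N (u r) (u r) := (N.continuous.comp hu).clm_apply hu
  have hgv : Continuous fun r => N (v r) (v r) := (N.continuous.comp hv).clm_apply hv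
  have hg : Continuous fun r => N (u r) (u r) - N (v r) (v r) := hgu.sub hgv
  have hdiff : u s - v s =
      T s (x - x') - ∫ r in (0 : ℝ)..s, K (s - r) (N (u r) (u r) - N (v r) (v r)) := by
    rw [hU s hs, hV s hs, map_sub (T s)]
    simp only [map_sub]
    rw [intervalIntegral.integral_sub (intervalIntegrable_duhamelIntegrand hK hKc hα hgu hs.1)
      (intervalIntegrable_duhamelIntegrand hK hKc hα hgv hs.1)]
    abel
  have hpt : ∀ r ∈ Icc 0 s, ‖N (u r) (u r) - N (v r) (v r)‖ ≤ ‖N‖ * (R + R) * d r := by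
    intro r hr
    have hr' : r ∈ Icc 0 L' := ⟨hr.1, hr.2.trans hs.2⟩
    calc ‖N (u r) (u r) - N (v r) (v r)‖ ≤ ‖N‖ * (‖u r‖ + ‖v r‖) * ‖u r - v r‖ :=
          Literature.Analysis.Calculus.norm_bilinear_diag_sub_le N _ _
      _ ≤ ‖N‖ * (R + R) * ‖u r - v r‖ := by
          gcongr
          · exact huR r hr'
          · exact hvR r hr'
  calc d s = ‖u s - v s‖ := rfl
    _ ≤ ‖T s (x - x')‖ + ‖∫ r in (0 : ℝ)..s, K (s - r) (N (u r) (u r) - N (v r) (v r))‖ := by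
        rw [hdiff]; exact norm_sub_le _ _
    _ ≤ ‖x - x'‖ + C * ∫ r in (0 : ℝ)..s, (s - r) ^ (-α) * ‖N (u r) (u r) - N (v r) (v r)‖ := by
        gcongr
        · calc ‖T s (x - x')‖ ≤ ‖T s‖ * ‖x - x'‖ := (T s).le_opNorm _
            _ ≤ 1 * ‖x - x'‖ := by gcongr; exact hTnorm s hs.1
            _ = ‖x - x'‖ := one_mul _
        · exact norm_integral_weaklySingular_le hα hK hg hs.1
    _ ≤ ‖x - x'‖ + C * ∫ r in (0 : ℝ)..s, (s - r) ^ (-α) * (‖N‖ * (R + R) * d r) := by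
        gcongr ‖x - x'‖ + C * ?_
        refine intervalIntegral.integral_mono_on hs.1 ?_ ?_ fun r hr => ?_
        · exact Literature.Analysis.ODE.intervalIntegrable_sub_rpow_neg_mul hα s hg.norm.continuousOn
        · exact Literature.Analysis.ODE.intervalIntegrable_sub_rpow_neg_mul hα s
            ((continuous_const.mul hdc).continuousOn)
        · exact mul_le_mul_of_nonneg_left (hpt r hr) (Real.rpow_nonneg (sub_nonneg.2 hr.2) _)
    _ = ‖x - x'‖ + (C * (‖N‖ * (R + R))) * ∫ r in (0 : ℝ)..s, (s - r) ^ (-α) * d r := by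
        rw [mul_assoc C, ← intervalIntegral.integral_const_mul (‖N‖ * (R + R))]
        congr 2
        refine intervalIntegral.integral_congr fun r _ => ?_
        ring

end Literature.Analysis.UnboundedOperators
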